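import Mathlib
import HarnessLib
import Summits.ValiantsHypothesis.ValiantsHypothesis.Theorems.PermanentalConesHyperbolicVPShadowStubLowEffGlue

/-!
# ValiantsHypothesis / PermanentalCones — `HyperbolicVPShadow`: the high layer is empty for `N ≤ 2`

Route `PermanentalCones`, item `stmt-ValiantsHypothesis-8655` (crux `HyperbolicVPShadow`), line
`birth`, stub `stub_spanDim_le_three_of_le_two`.

The crux is reduced in the lead's skeleton to linear pencils `P : ℝⁿ →ₗ Mat_N(ℝ)` all of whose
values have only real eigenvalues; its open "high layer" concerns those pencils for which
`V := span (1, range P)` has dimension `≥ 4`. This file shows that the high layer is EMPTY for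
`N ≤ 2`: there `dim V ≤ 3`.

Proof. For `N ≤ 1` the ambient space `Mat_N(ℝ)` has dimension `N² ≤ 1`. For `N = 2` it has
dimension `4`, so `dim V = 4` would force `V = Mat_2(ℝ)`, whence the rotation generator
`J = !![0, 1; -1, 0]` would lie in `V`, i.e. `J = a·1 + P x` for some `a : ℝ` and `x : ℝⁿ`; but
then `P x = (-a)·1 + J` has the non-real eigenvalue `i - a` (`det (J - i·1) = i² + 1 = 0`),
contradicting the real-spectrum hypothesis. All folklore linear algebra.
-/

set_option linter.dupNamespace false

noncomputable section

namespace Summit.ValiantsHypothesis.ValiantsHypothesis.Theorems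

open Matrix

/-- The rotation generator `J = !![0, 1; -1, 0]` has the eigenvalue `i`: over `ℂ`,
`det (J - i·1) = (-i)² + 1 = 0`. [folklore] -/
theorem permanentalCones_det_rotation_sub_I_smul_one :
    ((!![0, 1; -1, 0] : Matrix (Fin 2) (Fin 2) ℝ).map (algebraMap ℝ ℂ) -
        Complex.I • (1 : Matrix (Fin 2) (Fin 2) ℂ)).det = 0 := by
  simp [Matrix.det_fin_two]

/-- **The high layer of crux `HyperbolicVPShadow` is empty for `N ≤ 2`**: for a linear pencil `P`
of real `N × N` matrices, `N ≤ 2`, all of whose values have only real eigenvalues, the span of the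
identity and the values of `P` has dimension `≤ 3`. (For `N ≤ 1` the ambient dimension is `≤ 1`;
for `N = 2` a `4`-dimensional span would be all of `Mat_2(ℝ)` and contain the rotation generator
`!![0, 1; -1, 0] = a·1 + P x`, whose shift `P x` has the non-real eigenvalue `i - a`.)
[folklore] -/
theorem stub_spanDim_le_three_of_le_two :
    ∀ (n N : ℕ) (P : (Fin n → ℝ) →ₗ[ℝ] Matrix (Fin N) (Fin N) ℝ), N ≤ 2 →
      (∀ (x : Fin n → ℝ) (z : ℂ),
        ((P x).map (algebraMap ℝ ℂ) - z • (1 : Matrix (Fin N) (Fin N) ℂ)).det = 0 → z.im = 0) →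
      Module.finrank ℝ (Submodule.span ℝ
        (insert (1 : Matrix (Fin N) (Fin N) ℝ) (Set.range P))) ≤ 3 := by
  intro n N P hN hP
  -- the ambient dimension is `N²`
  have hamb : Module.finrank ℝ (Matrix (Fin N) (Fin N) ℝ) = N * N := by
    rw [Module.finrank_matrix, Module.finrank_self, mul_one, Fintype.card_fin]
  rcases hN.lt_or_eq with hlt | rfl
  · -- `N ≤ 1`: bounded by the ambient dimension `N² ≤ 1`
    have hN1 : N ≤ 1 := Nat.lt_succ_iff.mp hlt
    calc Module.finrank ℝ
          (Submodule.span ℝ (insert (1 : Matrix (Fin N) (Fin N) ℝ) (Set.range P)))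
        ≤ Module.finrank ℝ (Matrix (Fin N) (Fin N) ℝ) := Submodule.finrank_le _
      _ = N * N := hamb
      _ ≤ 1 * 1 := Nat.mul_le_mul hN1 hN1
      _ ≤ 3 := by norm_num
  · -- `N = 2`: a `4`-dimensional span would be everything
    set V : Submodule ℝ (Matrix (Fin 2) (Fin 2) ℝ) :=
      Submodule.span ℝ (insert (1 : Matrix (Fin 2) (Fin 2) ℝ) (Set.range P)) with hV
    by_contra h3
    have hle : Module.finrank ℝ V ≤ Module.finrank ℝ (Matrix (Fin 2) (Fin 2) ℝ) :=
      Submodule.finrank_le V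
    have hVtop : V = ⊤ := Submodule.eq_top_of_finrank_eq (by omega)
    -- so the rotation generator lies in `V`, i.e. `J = a·1 + P x`
    have hJ : (!![0, 1; -1, 0] : Matrix (Fin 2) (Fin 2) ℝ) ∈ V := by
      rw [hVtop]
      exact Submodule.mem_top
    rw [hV, Submodule.mem_span_insert] at hJ
    obtain ⟨a, Q, hQ, hJQ⟩ := hJ
    have hQ' : Q ∈ LinearMap.range P :=
      (Submodule.span_le.mpr (Set.range_subset_iff.mpr fun x => LinearMap.mem_range_self P x)) hQ
    obtain ⟨x, rfl⟩ := LinearMap.mem_range.1 hQ'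
    -- `P x = (-a)·1 + J` has the non-real eigenvalue `i - a`: contradiction
    have hPx : P x = (-a) • (1 : Matrix (Fin 2) (Fin 2) ℝ) + !![0, 1; -1, 0] := by
      rw [hJQ, neg_smul, neg_add_cancel_left]
    have him := hP x (Complex.I + ((-a : ℝ) : ℂ)) (by
      rw [hPx, permanentalCones_map_smul_one_add_sub, add_sub_cancel_right]
      exact permanentalCones_det_rotation_sub_I_smul_one)
    rw [Complex.add_im, Complex.I_im, Complex.ofReal_im, add_zero] at him
    exact one_ne_zero him

end Summit.ValiantsHypothesis.ValiantsHypothesis.Theorems
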